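import Mathlib
import Summits.NavierStokesRegularity.NavierStokesRegularity.Theorems.StretchingWellBindingTypeIBridgeTools
import Summits.NavierStokesRegularity.NavierStokesRegularity.Theses.StretchingWellBinding
import Summits.NavierStokesRegularity.NavierStokesRegularity.Theses.HalfHolderEnergy
import HarnessLib

/-!
# Converter `EQL ⇒ HHE`: the slice quarter law implies the window quarter law
  (helper for the shelf crux stmt-NavierStokesRegularity-1574 `EnstrophyQuarterLaw`, line
  `Cruxes/EnstrophyQuarterLaw/Lines/window_average`; also the moot-direction of route
  `HalfHolderEnergy`: item 25161 `EnergyHalfHolder` follows from item 1574)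

**Statement.** `Theses.StretchingWellBinding.EnstrophyQuarterLaw → Theses.HalfHolderEnergy.EnergyHalfHolder`:
if every maximal classical Leray–Hopf solution from a rapidly decaying datum obeys the SLICE law
`Ω(t) = ∫ |curl u(t)|² ≤ K / √(T − t)` on `[0, T)`, then it obeys the WINDOW law
`∫_a^b Ω(t) dt ≤ K₂ √(b − a)` for all `0 ≤ a ≤ b ≤ T` (with `K₂ = 2 max(K, 0)`).

PROOF (one integration, no PDE). For `a < t < b ≤ T` one has `√(b − t) ≤ √(T − t)`, so
`K⁺/√(T − t) ≤ K⁺/√(b − t)`; and `∫_a^b K⁺/√(b − t) dt = 2 K⁺ √(b − a)` is the tree's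
`TypeIBridge.lintegral_Ioo_const_div_sqrt_sub` (with `r = √(b − a)`, `s₀ = b`). The abstract
step is `WindowConverters.lintegral_Ioo_le_sqrt_of_slice_le` (any `Z : ℝ → [0, ∞]`).

HONEST FRAMING: elementary calculus relating two formulations of a HYPOTHETICAL enstrophy blow-up
rate; both `EnstrophyQuarterLaw` (stmt-1574) and `EnergyHalfHolder` (stmt-25161) are OPEN, and this
file proves only the implication between them. Nothing here bears on the regularity problem itself;
no summit statement is proved.
-/

noncomputable section

set_option linter.dupNamespace false

namespace Summit.NavierStokesRegularity.NavierStokesRegularity.Theorems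

open MeasureTheory Set Filter Function Literature.Analysis.FluidPDE
open scoped NNReal ENNReal

namespace WindowConverters

/-- **Slice bound ⇒ window bound (abstract).** If `Z(t) ≤ K/√(T − t)` for `t ∈ [0, T)` with
`K ≥ 0`, then `∫_{(a,b)} Z ≤ 2K √(b − a)` for all `0 ≤ a ≤ b ≤ T`: compare with `K/√(b − t)`
(`√(b − t) ≤ √(T − t)`) and integrate `∫_a^b (b − t)^{-1/2} dt = 2√(b − a)`. [folklore] -/
theorem lintegral_Ioo_le_sqrt_of_slice_le {Z : ℝ → ℝ≥0∞} {T K : ℝ} (hK : 0 ≤ K)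
    (hZ : ∀ t ∈ Ico 0 T, Z t ≤ ENNReal.ofReal (K / Real.sqrt (T - t)))
    {a b : ℝ} (ha : 0 ≤ a) (hab : a ≤ b) (hb : b ≤ T) :
    ∫⁻ t in Ioo a b, Z t ≤ ENNReal.ofReal (2 * K * Real.sqrt (b - a)) := by
  calc ∫⁻ t in Ioo a b, Z t ≤ ∫⁻ t in Ioo a b, ENNReal.ofReal (K / Real.sqrt (b - t)) := by
        refine setLIntegral_mono' measurableSet_Ioo fun t ht => ?_
        have htT : t ∈ Ico 0 T := ⟨ha.trans ht.1.le, ht.2.trans_le hb⟩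
        refine (hZ t htT).trans (ENNReal.ofReal_le_ofReal ?_)
        have h1 : 0 < Real.sqrt (b - t) := Real.sqrt_pos.2 (by linarith [ht.2])
        exact div_le_div_of_nonneg_left hK h1 (Real.sqrt_le_sqrt (by linarith))
    _ = ENNReal.ofReal (2 * K * Real.sqrt (b - a)) := by
        have h := TypeIBridge.lintegral_Ioo_const_div_sqrt_sub b (r := Real.sqrt (b - a)) (K := K)
          (Real.sqrt_nonneg _) hK
        rwa [Real.sq_sqrt (sub_nonneg.2 hab), sub_sub_cancel] at h

end WindowConverters

/-- **`EQL ⇒ HHE`: the slice quarter law implies the window quarter law** (energy `½`-Hölder):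
`EnstrophyQuarterLaw → EnergyHalfHolder`, by one integration in time of `K/√(T − t)` over each
window `[a, b] ⊆ [0, T]` (`∫_a^b (T − t)^{-1/2} dt ≤ 2√(b − a)`); window constant `2 max(K, 0)`.
[folklore] -/
theorem energyHalfHolder_of_enstrophyQuarterLaw :
    Theses.StretchingWellBinding.EnstrophyQuarterLaw → Theses.HalfHolderEnergy.EnergyHalfHolder := by
  intro hQ ν T hν hT u p hmax hLH hdec
  obtain ⟨K, hK⟩ := hQ ν T hν hT u p hmax hLH hdec
  refine ⟨2 * max K 0, fun a b ha hab hb => ?_⟩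
  have hK' : ∀ t ∈ Ico 0 T,
      ∫⁻ x, ‖curl (u t) x‖ₑ ^ 2 ≤ ENNReal.ofReal (max K 0 / Real.sqrt (T - t)) :=
    fun t ht => (hK t ht).trans
      (ENNReal.ofReal_le_ofReal (div_le_div_of_nonneg_right (le_max_left _ _) (Real.sqrt_nonneg _)))
  exact WindowConverters.lintegral_Ioo_le_sqrt_of_slice_le (le_max_right K 0) hK' ha hab hb

end Summit.NavierStokesRegularity.NavierStokesRegularity.Theorems

end
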